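import Summits.Ventures.HodgeRepro2.T5SU11KernelCompositionSymmetric

/-!
# Hilbert's resolvent identity for the kernels: `K_λ(t, s) − K_{λ₂}(t, s) = (μ − μ₂) ∫ K_λ(t, r) K_{λ₂}(r, s) sinh 2r dr`

Row 522's `G^I_λ K_{λ₂}(·, s)(t) = (K_λ(t, s) − K_{λ₂}(t, s))/(μ − μ₂)` and the kernel representation of `G^I_λ` on the
class source `K_{λ₂}(·, s)` (row 524) give the resolvent identity of the kernels in integral form:

* `kernel_hilbert_identity` — **`K_λ(t, s) − K_{λ₂}(t, s) = (μ − μ₂) ∫ K_λ(t, r) K_{λ₂}(r, s) sinh 2r dr`** for all `λ, λ₂ > 1`,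
  `t, s > 0` (both sides vanish for `λ = λ₂`);
* `kernel_hilbert_identity'` — the same with the kernels in the other order, `∫ K_{λ₂}(t, r) K_λ(r, s) sinh 2r dr`;
* `integral_kernel_mul_kernel_comm` — **`∫ K_λ(t, r) K_{λ₂}(r, s) sinh 2r dr = ∫ K_{λ₂}(t, r) K_λ(r, s) sinh 2r dr`**: the resolvents at
  two spectral points commute, on the level of kernels.

Nothing is claimed about (N).

Blind lane: Mathlib + the HodgeRepro2 prefix only; no sorry; axioms ⊆ {propext, Classical.choice,
Quot.sound}.
-/

namespace Summit.Ventures.HodgeRepro2.T5SU11KernelHilbertIdentity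

open Filter Topology MeasureTheory
open Set (Ioi Ioc)
open T5SU11Cartan T5SU11SphericalFunction T5SU11SphericalDecay T5SU11RadialGreenKernel T5SU11RadialGreenImproper
  T5SU11RadialGreenImproperDecaySource T5SU11ResolventKernelComposition T5SU11KernelDifferenceRegularity

section measure

variable [MeasurableSpace Circle] [BorelSpace Circle]

variable {lam lam₂ : ℝ} (hlam : 1 < lam) (hlam₂ : 1 < lam₂) {s : ℝ} (hs : 0 < s)

include hlam hlam₂ hs in
/-- **The resolvent applied to the kernel source, in integral form**:
`∫ K_λ(t, r) K_{λ₂}(r, s) sinh 2r dr = G^I_λ K_{λ₂}(·, s)(t)`. -/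
theorem integral_kernel_mul_kernel_eq {t : ℝ} (ht : 0 < t) :
    ∫ r in Ioi 0, sphGreenKernel lam t r * sphGreenKernel lam₂ r s * Real.sinh (2 * r)
      = greenSolI (fun t => sph lam (hyp t)) (sphDecay lam) (fun r => sphGreenKernel lam₂ r s) t := by
  obtain ⟨M, hM0, hM⟩ := kernel_source_bounded hlam₂ hs
  obtain ⟨C, s₀, hC⟩ := kernel_source_decay hlam₂ hs
  have hg := kernel_source_continuousOn hlam₂ hs
  have hε : 2 - lam < lam₂ := by linarith
  have hB := integrableOn_sph_mul_mul_sinh_Ioc hg hM hM0 lam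
  have hA := integrableOn_sphDecay_mul_mul_sinh hlam hg hM hM0 hε hC
  rw [greenSolI_eq_integral_kernel hB hA ht]
  apply setIntegral_congr_fun measurableSet_Ioi
  intro r _
  simp only [sphGreenKernel]

include hlam hlam₂ hs in
/-- **HILBERT'S RESOLVENT IDENTITY FOR THE KERNELS**:
`K_λ(t, s) − K_{λ₂}(t, s) = (μ − μ₂) ∫ K_λ(t, r) K_{λ₂}(r, s) sinh 2r dr` for every `λ, λ₂ > 1` and `t, s > 0`. -/
theorem kernel_hilbert_identity {t : ℝ} (ht : 0 < t) :
    sphGreenKernel lam t s - sphGreenKernel lam₂ t s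
      = (lam * (lam - 2) - lam₂ * (lam₂ - 2))
        * ∫ r in Ioi 0, sphGreenKernel lam t r * sphGreenKernel lam₂ r s * Real.sinh (2 * r) := by
  rw [integral_kernel_mul_kernel_eq hlam hlam₂ hs ht]
  rcases eq_or_ne lam lam₂ with heq | hne
  · subst heq
    simp
  · have hκ : lam * (lam - 2) - lam₂ * (lam₂ - 2) ≠ 0 := by
      have e : lam * (lam - 2) - lam₂ * (lam₂ - 2) = (lam - lam₂) * (lam + lam₂ - 2) := by ring
      rw [e]
      exact mul_ne_zero (sub_ne_zero.mpr hne) (by linarith)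
    rw [greenSolI_kernel_eq hlam hlam₂ hs hne ht, mul_div_cancel₀ _ hκ]

include hlam hlam₂ hs in
/-- Hilbert's identity with the kernels in the other order:
`K_λ(t, s) − K_{λ₂}(t, s) = (μ − μ₂) ∫ K_{λ₂}(t, r) K_λ(r, s) sinh 2r dr`. -/
theorem kernel_hilbert_identity' {t : ℝ} (ht : 0 < t) :
    sphGreenKernel lam t s - sphGreenKernel lam₂ t s
      = (lam * (lam - 2) - lam₂ * (lam₂ - 2))
        * ∫ r in Ioi 0, sphGreenKernel lam₂ t r * sphGreenKernel lam r s * Real.sinh (2 * r) := by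
  have h := kernel_hilbert_identity hlam₂ hlam hs ht
  have e : sphGreenKernel lam t s - sphGreenKernel lam₂ t s
      = -(sphGreenKernel lam₂ t s - sphGreenKernel lam t s) := by ring
  rw [e, h]
  ring

include hlam hlam₂ hs in
/-- **The resolvents at two spectral points commute, on the level of kernels**:
`∫ K_λ(t, r) K_{λ₂}(r, s) sinh 2r dr = ∫ K_{λ₂}(t, r) K_λ(r, s) sinh 2r dr` for every `λ, λ₂ > 1`, `t, s > 0`. -/
theorem integral_kernel_mul_kernel_comm {t : ℝ} (ht : 0 < t) :
    ∫ r in Ioi 0, sphGreenKernel lam t r * sphGreenKernel lam₂ r s * Real.sinh (2 * r)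
      = ∫ r in Ioi 0, sphGreenKernel lam₂ t r * sphGreenKernel lam r s * Real.sinh (2 * r) := by
  rcases eq_or_ne lam lam₂ with heq | hne
  · subst heq
    rfl
  · have hκ : lam * (lam - 2) - lam₂ * (lam₂ - 2) ≠ 0 := by
      have e : lam * (lam - 2) - lam₂ * (lam₂ - 2) = (lam - lam₂) * (lam + lam₂ - 2) := by ring
      rw [e]
      exact mul_ne_zero (sub_ne_zero.mpr hne) (by linarith)
    have h1 := kernel_hilbert_identity hlam hlam₂ hs ht
    have h2 := kernel_hilbert_identity' hlam hlam₂ hs ht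
    exact mul_left_cancel₀ hκ (h1.symm.trans h2)

end measure

end Summit.Ventures.HodgeRepro2.T5SU11KernelHilbertIdentity
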